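import Mathlib
import Literature.Barriers.MatrixMultiplication.NormalizerBarrier

/-!
# Leakage of the triple product property into a subgroup (finite shadow of Lemma 3.16)

Solo-blind seat (MatrixMultiplication), companion note `LieExponent.md`, §3.16 (Lemma 3.16
"centraliser leakage" and Theorem 4: `GL₃(ℝ)` has no TPP triple of three 4-dimensional Lie
subgroups).  The Lie-group lemma says: if `(H₁, H₂, H₃)` is a TPP triple of connected Lie subgroups
and `Z` is any connected Lie subgroup, the pieces `Kᵢ = (Hᵢ ∩ Z)⁰` form a TPP triple inside `Z`, so
`dim K₁ + dim K₂ ≤ dim Z − 1` as soon as `dim K₃ ≥ 1`; applied to the codimension-one subgroup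
`Z_W` of the centraliser of the common normal `Λ` this is the necessary condition (T5), and in
`GL₃(ℝ)` it is violated by every admissible triple.  This file proves the purely group-theoretic
core for subgroups of an arbitrary (finite, for the counting statement) group, on top of the tree's
`Literature.Barriers.MatrixMultiplication.SubgroupTPP`:

* `soloLie_subgroupTPP_inf`: the TPP passes to `(H₁ ⊓ Z₁, H₂ ⊓ Z₂, H₃ ⊓ Z₃)`;
* `soloLie_eq_of_tpp_of_mul_eq_mul`: `(a, b) ↦ a b` is injective on `H₁ × H₂`;
* `soloLie_mul_mem_iff_of_tpp`: `a b ∈ H₃` with `a ∈ H₁`, `b ∈ H₂` forces `a = b = 1` — the exact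
  form in which leakage kills a triple (`exp(tY₃) = exp(tαY₁) exp(tβY₂)` in the text);
* `soloLie_card_inf_mul_card_inf_add_card_inf_le`: for every subgroup `Z` of a finite group,
  `|H₁ ∩ Z| · |H₂ ∩ Z| + |H₃ ∩ Z| ≤ |Z| + 1` — the finite shadow of
  `dim K₁ + dim K₂ ≤ dim Z − [dim K₃ ≥ 1]` (the sets `(H₁ ∩ Z)(H₂ ∩ Z)` and `H₃ ∩ Z` lie in `Z` and
  meet only in `1`).
-/

set_option linter.dupNamespace false

namespace Summit.MatrixMultiplication.MatrixMultiplication.Theorems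

open Literature.Barriers.MatrixMultiplication

variable {G : Type*} [Group G] {H₁ H₂ H₃ : Subgroup G}

/-- The subgroup TPP passes to intersections with arbitrary subgroups (sub-triples of a TPP triple
are TPP). [folklore] -/
theorem soloLie_subgroupTPP_inf (h : SubgroupTPP H₁ H₂ H₃) (Z₁ Z₂ Z₃ : Subgroup G) :
    SubgroupTPP (H₁ ⊓ Z₁) (H₂ ⊓ Z₂) (H₃ ⊓ Z₃) := fun a ha b hb c hc e =>
  h a (Subgroup.mem_inf.1 ha).1 b (Subgroup.mem_inf.1 hb).1 c (Subgroup.mem_inf.1 hc).1 e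

/-- Under the subgroup TPP, `(a, b) ↦ a * b` is injective on `H₁ × H₂`. [folklore] -/
theorem soloLie_eq_of_tpp_of_mul_eq_mul (h : SubgroupTPP H₁ H₂ H₃) {a a' b b' : G}
    (ha : a ∈ H₁) (ha' : a' ∈ H₁) (hb : b ∈ H₂) (hb' : b' ∈ H₂) (e : a * b = a' * b') :
    a = a' ∧ b = b' := by
  have key : a'⁻¹ * a * (b * b'⁻¹) * 1 = 1 := by
    have : a'⁻¹ * a * (b * b'⁻¹) * 1 = a'⁻¹ * (a * b) * b'⁻¹ := by group
    rw [this, e]; group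
  obtain ⟨h1, h2, -⟩ := h _ (H₁.mul_mem (H₁.inv_mem ha') ha) _
    (H₂.mul_mem hb (H₂.inv_mem hb')) 1 H₃.one_mem key
  exact ⟨(inv_mul_eq_one.1 h1).symm, mul_inv_eq_one.1 h2⟩

/-- Under the subgroup TPP, a product `a * b` with `a ∈ H₁`, `b ∈ H₂` lies in `H₃` only if
`a = 1` and `b = 1`: the form in which "leakage" kills a triple. [folklore] -/
theorem soloLie_mul_mem_iff_of_tpp (h : SubgroupTPP H₁ H₂ H₃) {a b : G} (ha : a ∈ H₁)
    (hb : b ∈ H₂) : a * b ∈ H₃ ↔ a = 1 ∧ b = 1 := by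
  constructor
  · intro hab
    have key : a * b * (a * b)⁻¹ = 1 := mul_inv_cancel _
    obtain ⟨h1, h2, -⟩ := h a ha b hb _ (H₃.inv_mem hab) key
    exact ⟨h1, h2⟩
  · rintro ⟨rfl, rfl⟩
    simp

/-- **Finite shadow of centraliser leakage (LieExponent.md, Lemma 3.16).**  If `H₁, H₂, H₃ ≤ G`
satisfy the subgroup TPP and `Z ≤ G` is any subgroup of the finite group `G`, then
`|H₁ ∩ Z| · |H₂ ∩ Z| + |H₃ ∩ Z| ≤ |Z| + 1`: the product set `(H₁ ∩ Z)(H₂ ∩ Z)` has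
`|H₁ ∩ Z| · |H₂ ∩ Z|` elements, lies in `Z`, and meets `H₃ ∩ Z ⊆ Z` only in the identity. -/
theorem soloLie_card_inf_mul_card_inf_add_card_inf_le [Finite G] (h : SubgroupTPP H₁ H₂ H₃)
    (Z : Subgroup G) :
    Nat.card ↥(H₁ ⊓ Z) * Nat.card ↥(H₂ ⊓ Z) + Nat.card ↥(H₃ ⊓ Z) ≤ Nat.card ↥Z + 1 := by
  classical
  -- the three pieces as sets
  set K₁ : Set G := ((H₁ ⊓ Z : Subgroup G) : Set G) with hK₁
  set K₂ : Set G := ((H₂ ⊓ Z : Subgroup G) : Set G) with hK₂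
  set K₃ : Set G := ((H₃ ⊓ Z : Subgroup G) : Set G) with hK₃
  set f : G × G → G := fun p => p.1 * p.2 with hf
  set P : Set G := f '' (K₁ ×ˢ K₂) with hP
  have e1 : Nat.card ↥(H₁ ⊓ Z) = K₁.ncard := Nat.card_coe_set_eq K₁
  have e2 : Nat.card ↥(H₂ ⊓ Z) = K₂.ncard := Nat.card_coe_set_eq K₂
  have e3 : Nat.card ↥(H₃ ⊓ Z) = K₃.ncard := Nat.card_coe_set_eq K₃
  have eZ : Nat.card ↥Z = (Z : Set G).ncard := Nat.card_coe_set_eq (Z : Set G)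
  -- injectivity of multiplication on K₁ × K₂
  have hinj : Set.InjOn f (K₁ ×ˢ K₂) := by
    rintro ⟨a, b⟩ ⟨ha, hb⟩ ⟨a', b'⟩ ⟨ha', hb'⟩ hab
    have ha1 : a ∈ H₁ := (Subgroup.mem_inf.1 ha).1
    have ha1' : a' ∈ H₁ := (Subgroup.mem_inf.1 ha').1
    have hb2 : b ∈ H₂ := (Subgroup.mem_inf.1 hb).1
    have hb2' : b' ∈ H₂ := (Subgroup.mem_inf.1 hb').1
    obtain ⟨rfl, rfl⟩ := soloLie_eq_of_tpp_of_mul_eq_mul h ha1 ha1' hb2 hb2' hab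
    rfl
  have hPcard : P.ncard = K₁.ncard * K₂.ncard := by
    rw [hP, hinj.ncard_image, Set.ncard_prod]
  -- P ⊆ Z and K₃ ⊆ Z
  have hPZ : P ⊆ (Z : Set G) := by
    rintro x ⟨⟨a, b⟩, ⟨ha, hb⟩, rfl⟩
    exact Z.mul_mem (Subgroup.mem_inf.1 ha).2 (Subgroup.mem_inf.1 hb).2
  have hK₃Z : K₃ ⊆ (Z : Set G) := fun x hx => (Subgroup.mem_inf.1 hx).2
  -- P ∩ K₃ = {1}
  have hPK : P ∩ K₃ = {1} := by
    ext x
    constructor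
    · rintro ⟨⟨⟨a, b⟩, ⟨ha, hb⟩, rfl⟩, hx3⟩
      have ha1 : a ∈ H₁ := (Subgroup.mem_inf.1 ha).1
      have hb2 : b ∈ H₂ := (Subgroup.mem_inf.1 hb).1
      have hx3' : f (a, b) ∈ H₃ := (Subgroup.mem_inf.1 hx3).1
      obtain ⟨rfl, rfl⟩ := (soloLie_mul_mem_iff_of_tpp h ha1 hb2).1 hx3'
      simp [hf]
    · intro hx
      rw [Set.mem_singleton_iff] at hx
      subst hx
      refine ⟨⟨(1, 1), ⟨?_, ?_⟩, by simp [hf]⟩, ?_⟩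
      · exact (H₁ ⊓ Z).one_mem
      · exact (H₂ ⊓ Z).one_mem
      · exact (H₃ ⊓ Z).one_mem
  -- count
  have hunion : (P ∪ K₃).ncard + (P ∩ K₃).ncard = P.ncard + K₃.ncard :=
    Set.ncard_union_add_ncard_inter P K₃
  have hle : (P ∪ K₃).ncard ≤ (Z : Set G).ncard :=
    Set.ncard_le_ncard (Set.union_subset hPZ hK₃Z)
  rw [hPK, Set.ncard_singleton] at hunion
  rw [e1, e2, e3, eZ, ← hPcard]
  omega

end Summit.MatrixMultiplication.MatrixMultiplication.Theorems
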